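import Literature.AnabelianGeometry.EtaleTheta.ContH1MapCoeff
import Literature.AnabelianGeometry.EtaleTheta.ContH1ActionCongr
import Mathlib.Topology.Algebra.ContinuousMonoidHom
import HarnessLib

/-!
# Continuous `H¹`: transport along an isomorphism of acting groups with a compatible map of coefficient pairs
# (`[f] ↦ [e′ ∘ f ∘ e⁻¹]`; support file for [EtTh] Thm 1.6 (iii) / Remark 1.6.4 (c3))

Neukirch–Schmidt–Wingberg, *Cohomology of Number Fields*, I §2 / II §7: `H¹` is functorial in compatible pairs
[cite: NeukirchSchmidtWingberg2008, I §2 and II §7].  [EtTh] Thm. 1.6 (iii) p. 250 «the isomorphism of cohomology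
groups induced by `γ`» and Remark 1.6.4 p. 252 «any isomorphism `Π_{Xα} ⥲ Π_{Xβ}` preserves these profinite étale
theta functions» [cite: MochizukiEtTh2009, Rmk 1.6.4 pp.252-253].  In the tree's carrier `ContH1 φ A H` (abc-iut-L2-t1)
the transport along an isomorphism of the ACTING groups `e : G ≃ G₂` together with a continuous homomorphism of the
coefficient ambients `e′ : G′ → G′₂` (`e′(A) ≤ A₂`, `φ₂ ∘ e = e′ ∘ φ`) is so far available only in the [EtTh]-specific
form `ThetaSetting.transport` (`TemperedRigidity.lean`: `γ`, theta companion).  This file (abc-iut cell, seat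
abc-iut-w6-d081 gen 12; row «RMK164-D4/D5», piece D5) supplies the GENERIC operation and its naturality:
* `ContH1.mapIsoCocycle`, **`ContH1.mapIso`** `: ContH1 φ A H →* ContH1 φ₂ A₂ H₂`, `[f] ↦ [y ↦ e′ (f (e⁻¹ y))]`;
* `mapIso_mk`; **`comap_mapIso`** (naturality w.r.t. pull-backs `ContH1.comap` along a commuting square of acting
  groups `e ∘ ι = ι₂ ∘ e₀`); **`mapCoeff_mapIso`** (naturality w.r.t. coefficient push-forwards `ContH1.mapCoeff` along a
  commuting square of coefficient ambients `ψ₂ ∘ e′ = e″ ∘ ψ`); **`conj_mapIso`** (`mapIso (σ·x) = e(σ)·mapIso x`).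
DEF-BEARING generic API (style of `ContH1MapCoeff`); no instance, no notation, no `Prop` fact; nothing of [EtTh] asserted;
no side taken on [IUTchIII] Cor. 3.12.
-/

noncomputable section

namespace Literature.AnabelianGeometry.EtaleTheta

open scoped IsMulCommutative

namespace ContH1

section MapIso

variable {G G' G₂ G'₂ : Type*} [Group G] [TopologicalSpace G] [Group G'] [TopologicalSpace G'] [IsTopologicalGroup G']
  [Group G₂] [TopologicalSpace G₂] [Group G'₂] [TopologicalSpace G'₂] [IsTopologicalGroup G'₂]
  (φ : G →* G') (A : Subgroup G') [A.Normal] [IsMulCommutative A] (H : Subgroup G)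
  (φ₂ : G₂ →* G'₂) (A₂ : Subgroup G'₂) [A₂.Normal] [IsMulCommutative A₂] (H₂ : Subgroup G₂)
  (e : G ≃ₜ* G₂) (e' : G' →* G'₂) (he' : Continuous e') (hA : A.map e' ≤ A₂)
  (hH : ∀ y : G₂, y ∈ H₂ → e.symm y ∈ H) (hφ : ∀ g : G, φ₂ (e g) = e' (φ g))

/-- Transport of continuous cocycles along `(e, e′)`: `f ↦ (y ↦ e′ (f (e⁻¹ y)))`.
[cite: NeukirchSchmidtWingberg2008, I §2 and II §7] -/
def mapIsoCocycle : contCocycles φ A H →* contCocycles φ₂ A₂ H₂ where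
  toFun f := ⟨fun y => coeffHom A e' A₂ hA (f.1 ⟨e.symm y.1, hH y.1 y.2⟩),
    (continuous_coeffHom A e' A₂ hA he').comp
      (f.2.1.comp ((e.symm.continuous.comp continuous_subtype_val).subtype_mk _)),
    fun x y => by
      have hxy : (⟨e.symm (x * y).1, hH _ (x * y).2⟩ : H) = ⟨e.symm x.1, hH _ x.2⟩ * ⟨e.symm y.1, hH _ y.2⟩ :=
        Subtype.ext (by simp only [Subgroup.coe_mul, MulMemClass.mk_mul_mk, map_mul])
      show coeffHom A e' A₂ hA (f.1 ⟨e.symm (x * y).1, hH _ (x * y).2⟩) =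
        coeffHom A e' A₂ hA (f.1 ⟨e.symm x.1, hH _ x.2⟩) *
          MulAut.conjNormal (φ₂ (x : G₂)) (coeffHom A e' A₂ hA (f.1 ⟨e.symm y.1, hH _ y.2⟩))
      have hx : e' (φ ((⟨e.symm x.1, hH _ x.2⟩ : H) : G)) = φ₂ (x : G₂) := by
        show e' (φ (e.symm (x : G₂))) = φ₂ (x : G₂)
        rw [← hφ, ContinuousMulEquiv.apply_symm_apply]
      rw [hxy, f.2.2, map_mul, coeffHom_conjNormal, hx]⟩
  map_one' := Subtype.ext (funext fun _ => by simp)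
  map_mul' f g := Subtype.ext (funext fun y => by
    change coeffHom A e' A₂ hA ((f.1 * g.1) _) = coeffHom A e' A₂ hA (f.1 _) * coeffHom A e' A₂ hA (g.1 _)
    rw [Pi.mul_apply, map_mul])

/-- **Transport of `H¹` along an isomorphism of acting groups `e : G ≃ G₂` with a compatible coefficient map
`e′ : (G′, A) → (G′₂, A₂)`** (`φ₂ ∘ e = e′ ∘ φ`, `e⁻¹(H₂) ⊆ H`): `[f] ↦ [e′ ∘ f ∘ e⁻¹]` — «the isomorphism of cohomology
groups induced by `γ`» in general form. [cite: NeukirchSchmidtWingberg2008, I §2 and II §7] -/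
def mapIso : ContH1 φ A H →* ContH1 φ₂ A₂ H₂ :=
  QuotientGroup.map _ _ (mapIsoCocycle φ A H φ₂ A₂ H₂ e e' he' hA hH hφ) (by
    intro f hf
    obtain ⟨a, ha⟩ := (mem_contCoboundaries_iff _).mp (Subgroup.mem_subgroupOf.mp hf)
    refine Subgroup.mem_subgroupOf.mpr ((mem_contCoboundaries_iff _).mpr ⟨coeffHom A e' A₂ hA a, ?_⟩)
    funext y
    have := congrFun ha ⟨e.symm y.1, hH y.1 y.2⟩
    change coeffHom A e' A₂ hA (f.1 _) = _
    have hy : e' (φ ((⟨e.symm y.1, hH y.1 y.2⟩ : H) : G)) = φ₂ (y : G₂) := by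
      show e' (φ (e.symm (y : G₂))) = φ₂ (y : G₂)
      rw [← hφ, ContinuousMulEquiv.apply_symm_apply]
    rw [this, map_mul, map_inv, coeffHom_conjNormal, hy])

/-- `mapIso` on the class of a cocycle. [cite: NeukirchSchmidtWingberg2008, I §2 and II §7] -/
theorem mapIso_mk (f : H → A) (hf : f ∈ contCocycles φ A H) :
    mapIso φ A H φ₂ A₂ H₂ e e' he' hA hH hφ (ContH1.mk f hf) =
      ContH1.mk (fun y => coeffHom A e' A₂ hA (f ⟨e.symm y.1, hH y.1 y.2⟩))
        (mapIsoCocycle φ A H φ₂ A₂ H₂ e e' he' hA hH hφ ⟨f, hf⟩).2 := rfl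

/-- The value of a transported cocycle, read in `G′₂`: `(mapIso f)(y) = e′ (f (e⁻¹ y))`.
[cite: NeukirchSchmidtWingberg2008, I §2 and II §7] -/
theorem coe_mapIsoCocycle_apply (f : contCocycles φ A H) (y : H₂) :
    (((mapIsoCocycle φ A H φ₂ A₂ H₂ e e' he' hA hH hφ f).1 y : A₂) : G'₂) = e' (f.1 ⟨e.symm y.1, hH y.1 y.2⟩) := rfl

/-- **`mapIso` intertwines the conjugation actions**: `mapIso (σ·x) = e(σ)·(mapIso x)` (`H ⊴ G`, `H₂ ⊴ G₂`).
[cite: NeukirchSchmidtWingberg2008, I §2 and II §7] -/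
theorem conj_mapIso [IsTopologicalGroup G] [IsTopologicalGroup G₂] [H.Normal] [H₂.Normal] (σ : G) (x : ContH1 φ A H) :
    mapIso φ A H φ₂ A₂ H₂ e e' he' hA hH hφ (ContH1.conj φ A σ x) =
      ContH1.conj φ₂ A₂ (e σ) (mapIso φ A H φ₂ A₂ H₂ e e' he' hA hH hφ x) := by
  induction x using QuotientGroup.induction_on with
  | H f =>
    apply congrArg (QuotientGroup.mk (s := (contCoboundaries φ₂ A₂ H₂).subgroupOf (contCocycles φ₂ A₂ H₂)))
    apply Subtype.ext
    funext y
    apply Subtype.ext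
    change e' ((MulAut.conjNormal (φ σ) (f.1 (MulAut.conjNormal σ⁻¹ ⟨e.symm y.1, hH y.1 y.2⟩)) : A) : G') =
      ((MulAut.conjNormal (φ₂ (e σ)) (coeffHom A e' A₂ hA (f.1 ⟨e.symm (MulAut.conjNormal (e σ)⁻¹ y).1, _⟩)) : A₂) : G'₂)
    have harg : (MulAut.conjNormal σ⁻¹ ⟨e.symm y.1, hH y.1 y.2⟩ : H) =
        ⟨e.symm (MulAut.conjNormal (e σ)⁻¹ y).1, hH _ (MulAut.conjNormal (e σ)⁻¹ y).2⟩ := by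
      apply Subtype.ext
      apply e.injective
      simp [map_mul, map_inv]
    rw [harg]
    simp only [MulAut.conjNormal_apply, map_mul, map_inv, coe_coeffHom_apply, hφ]

end MapIso

/-! ### Naturality with respect to pull-backs along the acting groups -/

section ComapNaturality

variable {G₀ G G' G₀₂ G₂ G'₂ : Type*}
  [Group G₀] [TopologicalSpace G₀] [Group G] [TopologicalSpace G]
  [Group G'] [TopologicalSpace G'] [IsTopologicalGroup G']
  [Group G₀₂] [TopologicalSpace G₀₂] [Group G₂] [TopologicalSpace G₂]
  [Group G'₂] [TopologicalSpace G'₂] [IsTopologicalGroup G'₂]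
  (φ : G →* G') (A : Subgroup G') [A.Normal] [IsMulCommutative A] (H : Subgroup G)
  (φ₂ : G₂ →* G'₂) (A₂ : Subgroup G'₂) [A₂.Normal] [IsMulCommutative A₂] (H₂ : Subgroup G₂)
  (e : G ≃ₜ* G₂) (e' : G' →* G'₂) (he' : Continuous e') (hA : A.map e' ≤ A₂)
  (hH : ∀ y : G₂, y ∈ H₂ → e.symm y ∈ H) (hφ : ∀ g : G, φ₂ (e g) = e' (φ g))
  (ι : G₀ →* G) (hι : Continuous ι) (ι₂ : G₀₂ →* G₂) (hι₂ : Continuous ι₂)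
  {H₀ : Subgroup G₀} {H₀₂ : Subgroup G₀₂} (h₀ : H₀.map ι ≤ H) (h₀₂ : H₀₂.map ι₂ ≤ H₂)
  (e₀ : G₀ ≃ₜ* G₀₂) (hH₀ : ∀ y : G₀₂, y ∈ H₀₂ → e₀.symm y ∈ H₀) (hsq : ∀ g : G₀, e (ι g) = ι₂ (e₀ g))

/-- **`mapIso` commutes with `ContH1.comap`** along a commuting square of acting groups `e ∘ ι = ι₂ ∘ e₀`:
pulling back to `(G₀, H₀)` and transporting along `(e₀, e′)` equals transporting along `(e, e′)` and pulling back to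
`(G₀₂, H₀₂)`. [cite: NeukirchSchmidtWingberg2008, I §2 and II §7] -/
theorem comap_mapIso (x : ContH1 φ A H) :
    ContH1.comap φ₂ A₂ ι₂ hι₂ h₀₂ (mapIso φ A H φ₂ A₂ H₂ e e' he' hA hH hφ x) =
      mapIso (φ.comp ι) A H₀ (φ₂.comp ι₂) A₂ H₀₂ e₀ e' he' hA hH₀
        (fun g => by rw [MonoidHom.comp_apply, MonoidHom.comp_apply, ← hsq, hφ])
        (ContH1.comap φ A ι hι h₀ x) := by
  induction x using QuotientGroup.induction_on with
  | H f =>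
    apply congrArg (QuotientGroup.mk (s := (contCoboundaries (φ₂.comp ι₂) A₂ H₀₂).subgroupOf
      (contCocycles (φ₂.comp ι₂) A₂ H₀₂)))
    apply Subtype.ext
    funext y
    change coeffHom A e' A₂ hA (f.1 ⟨e.symm (ι₂ y.1), _⟩) = coeffHom A e' A₂ hA (f.1 ⟨ι (e₀.symm y.1), _⟩)
    refine congrArg (fun a => coeffHom A e' A₂ hA (f.1 a)) (Subtype.ext ?_)
    show e.symm (ι₂ (y : G₀₂)) = ι (e₀.symm (y : G₀₂))
    apply e.injective
    rw [ContinuousMulEquiv.apply_symm_apply, hsq, ContinuousMulEquiv.apply_symm_apply]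

end ComapNaturality

/-! ### Naturality with respect to coefficient push-forwards -/

section MapCoeffNaturality

variable {G G' G'' G₂ G'₂ G''₂ : Type*}
  [Group G] [TopologicalSpace G] [Group G'] [TopologicalSpace G'] [IsTopologicalGroup G']
  [Group G''] [TopologicalSpace G''] [IsTopologicalGroup G'']
  [Group G₂] [TopologicalSpace G₂] [Group G'₂] [TopologicalSpace G'₂] [IsTopologicalGroup G'₂]
  [Group G''₂] [TopologicalSpace G''₂] [IsTopologicalGroup G''₂]
  (φ : G →* G') (A : Subgroup G') [A.Normal] [IsMulCommutative A] (H : Subgroup G)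
  (φ₂ : G₂ →* G'₂) (A₂ : Subgroup G'₂) [A₂.Normal] [IsMulCommutative A₂] (H₂ : Subgroup G₂)
  (e : G ≃ₜ* G₂) (e' : G' →* G'₂) (he' : Continuous e') (hA : A.map e' ≤ A₂)
  (hH : ∀ y : G₂, y ∈ H₂ → e.symm y ∈ H) (hφ : ∀ g : G, φ₂ (e g) = e' (φ g))
  (ψ : G' →* G'') (hψ : Continuous ψ) (A'' : Subgroup G'') [A''.Normal] [IsMulCommutative A''] (hψA : A.map ψ ≤ A'')
  (ψ₂ : G'₂ →* G''₂) (hψ₂ : Continuous ψ₂) (A''₂ : Subgroup G''₂) [A''₂.Normal] [IsMulCommutative A''₂]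
  (hψA₂ : A₂.map ψ₂ ≤ A''₂)
  (e'' : G'' →* G''₂) (he'' : Continuous e'') (hA'' : A''.map e'' ≤ A''₂) (hsq : ∀ g : G', ψ₂ (e' g) = e'' (ψ g))

/-- **`mapIso` commutes with `ContH1.mapCoeff`** along a commuting square of coefficient ambients `ψ₂ ∘ e′ = e″ ∘ ψ`:
pushing the coefficients forward and transporting along `(e, e″)` equals transporting along `(e, e′)` and pushing
forward. [cite: NeukirchSchmidtWingberg2008, I §2 and II §7] -/
theorem mapCoeff_mapIso (x : ContH1 φ A H) :
    mapCoeff φ₂ A₂ ψ₂ hψ₂ A''₂ hψA₂ H₂ (mapIso φ A H φ₂ A₂ H₂ e e' he' hA hH hφ x) =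
      mapIso (ψ.comp φ) A'' H (ψ₂.comp φ₂) A''₂ H₂ e e'' he'' hA'' hH
        (fun g => by rw [MonoidHom.comp_apply, MonoidHom.comp_apply, hφ, hsq])
        (mapCoeff φ A ψ hψ A'' hψA H x) := by
  induction x using QuotientGroup.induction_on with
  | H f =>
    apply congrArg (QuotientGroup.mk (s := (contCoboundaries (ψ₂.comp φ₂) A''₂ H₂).subgroupOf
      (contCocycles (ψ₂.comp φ₂) A''₂ H₂)))
    apply Subtype.ext
    funext y
    apply Subtype.ext
    exact hsq _

end MapCoeffNaturality

end ContH1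

end Literature.AnabelianGeometry.EtaleTheta

end
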